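import Literature.Geometry.Lorentzian.IdealPoints
import Literature.Geometry.Lorentzian.GeodesicIncompleteness
import HarnessLib

/-!
# Visible events, the visible region, and visible future-incomplete null rays
(definition item `defn-VisibleIncompleteNullRay` for route
`FinalStateConjecture/CurvatureOrSymmetry`; the same idiom is inlined in route
`FinalStateConjecture/BondiDrainDispersal`)

For a time-oriented Lorentzian manifold `(M, g, τ)` developing from data on a hypersurface
`ι : X → M` with future unit normal `N` — the vocabulary of `NullInfinity` (Christodoulou's
*normalised future null rays* `IsNormalisedNullRayFrom`: maximal null geodesics `δ` with affine
domain `s ∋ 0`, `δ 0 = ι p`, `g(δ' 0, N p) = -1`) — this file packages the **intrinsic,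
ray-theoretic rendering of "the (chronological) past of future null infinity"** used verbatim by
the routes `CurvatureOrSymmetry` (decls `NoFourthExit`, `NoVacuumFountains`, `CurvatureModeExit`,
`VisibleIncompleteRay`) and `BondiDrainDispersal` (decls `CensoredHorizonlessDisperse`,
`GenericCensoredHolesSettle`, and the Minkowski sanity item) of the `FinalStateConjecture` summit:

* `LorentzianMetric.IsVisibleEvent g τ ι N q` : the event `q ∈ M` **is visible from infinity** —
  there are `p : X` and a normalised future null ray `δ` from `p` with affine domain `s` which is
  **future complete** (`¬ BddAbove s`) such that `q ∈ I⁻(δ(s ∩ [0, ∞)))`: `q` can send a timelike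
  signal to the far part of a complete outgoing light ray issued from the data. This renders
  `q ∈ J⁻(𝓘⁺)` — "the region from which particles or photons can escape to infinity"
  (Hawking–Ellis 1973, §9.2, p. 312), the complement of the black-hole region
  `B = M ∖ J⁻(𝓘⁺)` (Wald 1984, §12.1, p. 300; Dafermos–Rodnianski, arXiv:0811.0354, §2.5.1 and
  §2.5.4: "if `𝓘⁺` is indeed complete, we can define the black hole region as the complement in
  `M` of `J⁻(𝓘⁺)`") — without a conformal boundary: the ideal endpoint of a *complete*
  normalised null ray plays the role of a point of `𝓘⁺`, exactly as complete normalised rays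
  express the completeness of `𝓘⁺` in Christodoulou, CQG 16 (1999) A23, pp. A26–A27
  (`HasCompleteFutureNullInfinity`).
* `LorentzianMetric.visibleRegion g τ ι N : Set M` : the set of visible events, the intrinsic
  `I⁻(𝓘⁺) ∩ M` (domain of outer communications of the development to the future of the data);
  `BondiDrainDispersal`'s "NO EVENT HORIZON" is `visibleRegion = univ`
  (`not_isVisibleEvent_iff` is, word for word, its inlined horizon predicate).
* `LorentzianMetric.IsVisibleIncompleteNullRay g τ ι N γ dom` : `γ` with affine domain `dom` is a
  **visible future-incomplete null ray** — a maximal (inextendible) geodesic of the Levi-Civita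
  connection on the open interval `dom ∋ 0`, with `dom` bounded above (future incomplete: finite
  affine length to the future, Hawking–Ellis 1973, §8.1, pp. 257–258), null future-directed
  velocity at every parameter, and every event `γ t`, `t ∈ dom`, `t ≥ 0`, visible from infinity.
  This is, conjunct for conjunct and in the same order, the predicate on `(γ, dom)` inlined four
  times in route `CurvatureOrSymmetry` (`isVisibleIncompleteNullRay_iff` unfolds it by `Iff.rfl`):
  a singularity (incomplete null geodesic) which is **naked**, "i.e. visible from `𝓘⁺`"
  (Hawking–Ellis 1973, §9.2, p. 311; Prop. 9.2.1: "cannot intersect `J⁻(𝓘⁺, M̄)`, i.e. cannot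
  be seen from `𝓘⁺`").
* `DataEmbedding.IsVisibleEvent`, `DataEmbedding.visibleRegion`,
  `DataEmbedding.IsVisibleIncompleteNullRay` : the same for a data embedding / Cauchy development
  `𝒟 = (M, g, τ, ι, ν)` of an initial data set (`CauchyDevelopment`, `VacuumCauchyDevelopment`
  extend `DataEmbedding`, so `𝒟.IsVisibleIncompleteNullRay γ dom` is available for them by dot
  notation), with the standing Levi-Civita hypothesis `[𝒟.metric.HasLeviCivita]` taken from the
  context exactly as the route statements bind it (`∀ [𝒟.metric.HasLeviCivita], ∃ γ dom, …`);
  `DataEmbedding.isVisibleIncompleteNullRay_iff` restates the route text verbatim.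

## Results

* `isPastSet_visibleRegion` : **the visible events form a past set**, `I⁻(visibleRegion) ⊆
  visibleRegion` (transitivity of `≪`; Hawking–Ellis 1973, §6.8, p. 217), and its pointwise form
  `IsVisibleEvent.of_mem_chronologicalPast`;
* `isOpen_visibleRegion` : on a manifold without boundary the visible region is open (openness of
  `I⁻`, O'Neill 1983, Ch. 14, Lemma 14.3);
* `chronologicalPast_subset_visibleRegion` : the past of the nonnegative half of a complete
  normalised ray is visible; `not_isVisibleEvent_iff` (the horizon idiom of `BondiDrainDispersal`);
* `IsVisibleIncompleteNullRay.isFutureNullGeodesicallyIncomplete` /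
  `.not_isNullGeodesicallyComplete` : a spacetime with a visible incomplete null ray is future null
  geodesically incomplete, hence (Hausdorff, without boundary, `C¹` connection) not null
  geodesically complete — it is singular in the sense of Hawking–Ellis 1973, §8.1;
* the projections of `IsVisibleIncompleteNullRay` and the development-level unfolding lemmas.

## Design choices

* **Chronological, not causal, past.** The routes use `I⁻` (`chronologicalPast`) of the ray, not
  `J⁻`; so do we. The visible region is then open and a past set with the tree's proved causality
  API, and nothing is lost for the intended use (a point causally preceding a far point of a
  complete ray chronologically precedes slightly later far points after the usual push-up, which we
  do not need here).
* **Only the nonnegative-parameter half `δ(s ∩ [0, ∞))` of the ray counts**, as in both routes: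
  the ray is issued from the data hypersurface at parameter `0` and "far away" means late affine
  parameter on a complete ray.
* **Name.** The item asked for a point predicate `IsVisibleFromInfinity q`; that name is taken in
  this namespace by `LorentzianMetric.IsVisibleFromInfinity g τ ι N P` of `IdealPoints`, a
  *different* notion (a **set** `P` seen by the **incomplete**, bounded-sojourn rays witnessing the
  incompleteness of `𝓘⁺` — visibility of a naked ideal point). The present notion — an event in
  the past of a **complete** ray — is therefore called `IsVisibleEvent`, matching the requested
  `IsVisibleIncompleteNullRay` (a visible ray is one whose events `γ t`, `t ≥ 0`, are visible
  events). The two visibilities are logically independent and are not related in this file.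
* Definitions are stated at the metric level in the generality of `NullInfinity` (any model with
  corners, any `X`, any map `ι`), and specialised to `DataEmbedding D` (hence to Cauchy
  developments) by one-line wrappers, as `IdealPoints` does for first naked points.

## What is not here

* **Invariance under isometry of developments** (`DataEmbedding.IsIsometricTo`): it needs the
  transport of maximal geodesics, null future-directed vectors, chronological pasts and future unit
  normals under a time-orientation-preserving isometry `ψ` with `ψ ∘ ι₁ = ι₂`, which the tree does
  not yet provide (the corresponding statement for `HasCompleteFutureNullInfinity` is the
  undischarged named fact `Development.hasCompleteFutureNullInfinity_iff_of_isIsometricTo` of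
  `NullInfinity`); no named fact is minted for it here (D-0026).
* No relation between `IsVisibleEvent` and `HasCompleteFutureNullInfinity` /
  `IsVisibleFromInfinity` is asserted: none holds formally in this generality.

## References

* S. W. Hawking, G. F. R. Ellis, *The large scale structure of space-time*, CUP 1973, §8.1
  (pp. 256–259: geodesic incompleteness), §9.2 (pp. 310–312: "naked, i.e. visible from `𝓘⁺`";
  Prop. 9.2.1; the event horizon `J̇⁻(𝓘⁺, M̄)`), §6.8 (p. 217: past sets).
* R. M. Wald, *General Relativity*, Chicago 1984, §12.1, pp. 299–300 (`B = M ∖ J⁻(𝓘⁺)`).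
* M. Dafermos, I. Rodnianski, *Lectures on black holes and linear waves*, arXiv:0811.0354, §2.5.1
  (black hole `𝒬 ∖ J⁻(𝓘⁺)`, domain of outer communications), §2.5.4 (general definitions).
* D. Christodoulou, *On the global initial value problem and the issue of singularities*,
  Class. Quantum Grav. 16 (1999) A23–A35, pp. A26–A27 (normalised null rays, complete `𝓘⁺`).
* B. O'Neill, *Semi-Riemannian geometry*, Academic Press 1983, Ch. 14, Lemma 14.3, p. 402.
-/

open Bundle Set
open scoped Manifold ContDiff Topology

noncomputable section

namespace Literature.Geometry.Lorentzian

variable {E : Type*} [NormedAddCommGroup E] [NormedSpace ℝ E] {H : Type*} [TopologicalSpace H]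
  {I : ModelWithCorners ℝ E H} {M : Type*} [TopologicalSpace M] [ChartedSpace H M]
  [IsManifold I ∞ M] {X : Type*}

namespace LorentzianMetric

variable (g : LorentzianMetric I ∞ M) (τ : TimeOrientation g) (ι : X → M)
  [FiniteDimensional ℝ E] [g.HasLeviCivita] (N : NormalField I ι)

/-! ### Visible events and the visible region -/

/-- The event `q ∈ M` **is visible from infinity** in the development `(M, g, τ)` of data on
`ι : X → M` with future unit normal `N`: there are a point `p : X` and a normalised future null
ray `δ` from `p` (`IsNormalisedNullRayFrom`: maximal null geodesic, `δ 0 = ι p`,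
`g(δ' 0, N p) = -1`) with affine domain `s` which is **future complete** (`s` is not bounded
above) such that `q` lies in the chronological past `I⁻(δ(s ∩ [0, ∞)))` of its nonnegative-
parameter half. This is the intrinsic (conformal-boundary-free) rendering of `q ∈ J⁻(𝓘⁺)`,
"the region from which particles or photons can escape to infinity", i.e. of `q ∉ B` for the
black-hole region `B = M ∖ J⁻(𝓘⁺)` (Hawking–Ellis 1973, §9.2, p. 312; Wald 1984, §12.1,
p. 300; Dafermos–Rodnianski, arXiv:0811.0354, §2.5.4: "if `𝓘⁺` is indeed complete, we can
define the black hole region as the complement in `M` of `J⁻(𝓘⁺)`"), the ideal endpoint of a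
complete normalised ray standing for a point of `𝓘⁺` as in Christodoulou's intrinsic notion of
complete future null infinity (CQG 16 (1999) A23, pp. A26–A27). It is, verbatim, the visibility
clause inlined in route `CurvatureOrSymmetry` of `FinalStateConjecture`, and its negation is (after
pushing `¬` through, `not_isVisibleEvent_iff`) the horizon clause inlined in `BondiDrainDispersal`.
Not to be confused with `IsVisibleFromInfinity` (`IdealPoints`: a set seen by the *incomplete*
rays witnessing the incompleteness of `𝓘⁺`). [cite: HawkingEllis1973CUP, §9.2, p. 312] -/
def IsVisibleEvent (q : M) : Prop :=
  ∃ (p : X) (δ : ℝ → M) (s : Set ℝ), g.IsNormalisedNullRayFrom τ ι N p δ s ∧ ¬ BddAbove s ∧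
    q ∈ g.chronologicalPast τ (δ '' (s ∩ Ici 0))

/-- The **visible region** of the development `(M, g, τ)` of data on `ι : X → M` with future
unit normal `N`: the set of events visible from infinity (`IsVisibleEvent`), i.e. the union of the
chronological pasts `I⁻(δ(s ∩ [0, ∞)))` over all future-complete normalised null rays `δ` from the
data hypersurface — the intrinsic rendering of `I⁻(𝓘⁺) ∩ M`, the complement of the black-hole
region `B = M ∖ J⁻(𝓘⁺)` (Wald 1984, §12.1, p. 300; Hawking–Ellis 1973, §9.2, p. 312;
Dafermos–Rodnianski, arXiv:0811.0354, §2.5.1, §2.5.4). [cite: Wald1984GR, §12.1, p. 300] -/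
def visibleRegion : Set M :=
  {q | g.IsVisibleEvent τ ι N q}

variable {g τ ι N}

/-- Unfolding lemma for `IsVisibleEvent`. [folklore] -/
lemma isVisibleEvent_iff {q : M} :
    g.IsVisibleEvent τ ι N q ↔
      ∃ (p : X) (δ : ℝ → M) (s : Set ℝ), g.IsNormalisedNullRayFrom τ ι N p δ s ∧ ¬ BddAbove s ∧
        q ∈ g.chronologicalPast τ (δ '' (s ∩ Ici 0)) :=
  Iff.rfl

/-- Membership in the visible region is visibility from infinity. [folklore] -/
@[simp]
lemma mem_visibleRegion_iff {q : M} : q ∈ g.visibleRegion τ ι N ↔ g.IsVisibleEvent τ ι N q :=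
  Iff.rfl

/-- **The horizon idiom of route `BondiDrainDispersal`**: `q` is *not* visible from infinity iff it
lies outside the chronological past `I⁻(γ(dom ∩ [0, ∞)))` of every future-complete normalised
null ray `γ` from the data hypersurface — `q` is in the (intrinsic) black-hole region
`M ∖ J⁻(𝓘⁺)` (Wald 1984, §12.1, p. 300; Dafermos–Rodnianski, arXiv:0811.0354, §2.5.4).
[cite: Wald1984GR, §12.1, p. 300] -/
lemma not_isVisibleEvent_iff {q : M} :
    ¬ g.IsVisibleEvent τ ι N q ↔
      ∀ (p : X) (γ : ℝ → M) (dom : Set ℝ), g.IsNormalisedNullRayFrom τ ι N p γ dom →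
        ¬ BddAbove dom → q ∉ g.chronologicalPast τ (γ '' (dom ∩ Ici 0)) := by
  simp only [isVisibleEvent_iff, not_exists, not_and]

/-- The chronological past of the nonnegative-parameter half of a future-complete normalised null
ray from the data hypersurface consists of visible events. Hawking–Ellis 1973, §9.2, p. 312.
[cite: HawkingEllis1973CUP, §9.2, p. 312] -/
lemma chronologicalPast_subset_visibleRegion {p : X} {δ : ℝ → M} {s : Set ℝ}
    (hδ : g.IsNormalisedNullRayFrom τ ι N p δ s) (hs : ¬ BddAbove s) :
    g.chronologicalPast τ (δ '' (s ∩ Ici 0)) ⊆ g.visibleRegion τ ι N :=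
  fun _ hq ↦ ⟨p, δ, s, hδ, hs, hq⟩

/-- **Visibility is inherited by the chronological past**: if `q` is visible from infinity and
`r ≪ q` (`r ∈ I⁻(q)`), then `r` is visible from infinity (transitivity of `≪`,
`mem_chronologicalPast_trans`). Hawking–Ellis 1973, §6.8, p. 217 (past sets); O'Neill 1983,
Ch. 14, p. 402. [cite: HawkingEllis1973CUP, §6.8, p. 217] -/
lemma IsVisibleEvent.of_mem_chronologicalPast {q r : M} (hq : g.IsVisibleEvent τ ι N q)
    (hr : r ∈ g.chronologicalPast τ {q}) : g.IsVisibleEvent τ ι N r := by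
  obtain ⟨p, δ, s, hδ, hs, hq⟩ := hq
  exact ⟨p, δ, s, hδ, hs, mem_chronologicalPast_trans hq hr⟩

variable (g τ ι N) in
/-- **The visible events form a past set**: `I⁻(visibleRegion) ⊆ visibleRegion` — the visible
region is a union of chronological pasts, and chronological pasts are past sets
(`isPastSet_chronologicalPast`). This is the intrinsic counterpart of `I⁻(J⁻(𝓘⁺)) ⊆ J⁻(𝓘⁺)`.
Hawking–Ellis 1973, §6.8, p. 217 ("a past set, i.e. `I⁻(𝒲) ⊂ 𝒲`"); §9.2, p. 312.
[cite: HawkingEllis1973CUP, §6.8, p. 217] -/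
theorem isPastSet_visibleRegion : g.IsPastSet τ (g.visibleRegion τ ι N) := by
  rintro r ⟨q, hq, hr⟩
  exact IsVisibleEvent.of_mem_chronologicalPast hq ⟨q, rfl, hr⟩

variable (g τ ι N) in
/-- The visible region is the union, over the future-complete normalised null rays `δ` from the data
hypersurface, of the chronological pasts `I⁻(δ(s ∩ [0, ∞)))` of their nonnegative-parameter halves
(the intrinsic `I⁻(𝓘⁺) = ⋃_{q ∈ 𝓘⁺} I⁻(q)`). [folklore] -/
lemma visibleRegion_eq_iUnion :
    g.visibleRegion τ ι N =
      ⋃ (p : X) (δ : ℝ → M) (s : Set ℝ) (_ : g.IsNormalisedNullRayFrom τ ι N p δ s ∧ ¬ BddAbove s),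
        g.chronologicalPast τ (δ '' (s ∩ Ici 0)) := by
  ext q
  simp only [mem_visibleRegion_iff, isVisibleEvent_iff, mem_iUnion, exists_prop, and_assoc]

variable (g τ ι N) in
/-- **The visible region is open** on a manifold without boundary: it is a union of chronological
pasts, which are open (`isOpen_chronologicalPast_of_boundaryless`; O'Neill 1983, Ch. 14,
Lemma 14.3). Hawking–Ellis 1973, §9.2, p. 312 (the event horizon `J̇⁻(𝓘⁺, M̄)` is the
boundary of the past of `𝓘⁺`). [cite: HawkingEllis1973CUP, §9.2, p. 312] -/
theorem isOpen_visibleRegion [BoundarylessManifold I M] : IsOpen (g.visibleRegion τ ι N) := by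
  rw [isOpen_iff_mem_nhds]
  rintro q ⟨p, δ, s, hδ, hs, hq⟩
  exact Filter.mem_of_superset ((isOpen_chronologicalPast_of_boundaryless g τ _).mem_nhds hq)
    (chronologicalPast_subset_visibleRegion hδ hs)

/-! ### Visible future-incomplete null rays -/

variable (g τ ι N) in
/-- `γ` with affine domain `dom` is a **visible future-incomplete null ray** of the development
`(M, g, τ)` of data on `ι : X → M` with future unit normal `N`: `γ` is a maximal (inextendible in
`M`) geodesic of the Levi-Civita connection of `g` on the open interval `dom ∋ 0`; `dom` is
bounded above, i.e. `γ` is **future incomplete** (finite affine length to the future and no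
extension: Hawking–Ellis 1973, §8.1, pp. 257–258); the velocity `γ' t` is null and
future-directed at every `t ∈ dom`; and `γ` is **visible from infinity**: every event `γ t` with
`t ∈ dom`, `t ≥ 0`, is a visible event (`IsVisibleEvent`: it lies in the chronological past
`I⁻(δ(s ∩ [0, ∞)))` of some future-complete normalised null ray `δ` from the data hypersurface).
Such a `γ` is an incomplete null geodesic which is *naked*, "i.e. visible from `𝓘⁺`"
(Hawking–Ellis 1973, §9.2, p. 311; Prop. 9.2.1: a set "cannot intersect `J⁻(𝓘⁺, M̄)`, i.e.
cannot be seen from `𝓘⁺`"), in the intrinsic idiom of `IsVisibleEvent`. This is, conjunct for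
conjunct, the predicate on `(γ, dom)` inlined in the items `NoFourthExit`, `NoVacuumFountains`,
`CurvatureModeExit` and `VisibleIncompleteRay` of route `FinalStateConjecture/CurvatureOrSymmetry`
(`isVisibleIncompleteNullRay_iff`). [cite: HawkingEllis1973CUP, §9.2, p. 311 and Prop. 9.2.1, and §8.1, pp. 257–258] -/
def IsVisibleIncompleteNullRay (γ : ℝ → M) (dom : Set ℝ) : Prop :=
  IsMaximalGeodesicOn g.leviCivita γ dom ∧ (0 : ℝ) ∈ dom ∧ BddAbove dom ∧
    (∀ t ∈ dom, g.IsNull (velocity I γ t) ∧ τ.IsFutureDirected (velocity I γ t)) ∧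
    ∀ t ∈ dom, 0 ≤ t → g.IsVisibleEvent τ ι N (γ t)

/-- Unfolding lemma: `IsVisibleIncompleteNullRay` is, verbatim, the predicate inlined in route
`CurvatureOrSymmetry` (maximal geodesic, `0 ∈ dom`, `BddAbove dom`, null future-directed
velocities, and for every `t ∈ dom` with `0 ≤ t` a future-complete normalised null ray from the
data whose nonnegative half has `γ t` in its chronological past). [folklore] -/
lemma isVisibleIncompleteNullRay_iff {γ : ℝ → M} {dom : Set ℝ} :
    g.IsVisibleIncompleteNullRay τ ι N γ dom ↔
      IsMaximalGeodesicOn g.leviCivita γ dom ∧ (0 : ℝ) ∈ dom ∧ BddAbove dom ∧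
        (∀ t ∈ dom, g.IsNull (velocity I γ t) ∧ τ.IsFutureDirected (velocity I γ t)) ∧
        ∀ t ∈ dom, 0 ≤ t → ∃ (p : X) (δ : ℝ → M) (s : Set ℝ),
          g.IsNormalisedNullRayFrom τ ι N p δ s ∧ ¬ BddAbove s ∧
            γ t ∈ g.chronologicalPast τ (δ '' (s ∩ Ici 0)) :=
  Iff.rfl

namespace IsVisibleIncompleteNullRay

variable {γ : ℝ → M} {dom : Set ℝ}

/-- A visible incomplete null ray is a maximal geodesic on its domain. [folklore] -/
lemma isMaximalGeodesicOn (h : g.IsVisibleIncompleteNullRay τ ι N γ dom) :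
    IsMaximalGeodesicOn g.leviCivita γ dom :=
  h.1

/-- The parameter `0` belongs to the domain of a visible incomplete null ray. [folklore] -/
lemma zero_mem (h : g.IsVisibleIncompleteNullRay τ ι N γ dom) : (0 : ℝ) ∈ dom :=
  h.2.1

/-- The domain of a visible incomplete null ray is nonempty. [folklore] -/
lemma nonempty (h : g.IsVisibleIncompleteNullRay τ ι N γ dom) : dom.Nonempty :=
  ⟨0, h.zero_mem⟩

/-- The domain of a visible incomplete null ray is open. [folklore] -/
lemma isOpen (h : g.IsVisibleIncompleteNullRay τ ι N γ dom) : IsOpen dom :=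
  h.isMaximalGeodesicOn.isOpen

/-- The domain of a visible incomplete null ray is an interval. [folklore] -/
lemma ordConnected (h : g.IsVisibleIncompleteNullRay τ ι N γ dom) : dom.OrdConnected :=
  h.isMaximalGeodesicOn.2.1

/-- A visible incomplete null ray is **future incomplete**: its affine domain is bounded above.
Hawking–Ellis 1973, §8.1, pp. 257–258. [cite: HawkingEllis1973CUP, §8.1, pp. 257–258] -/
lemma bddAbove (h : g.IsVisibleIncompleteNullRay τ ι N γ dom) : BddAbove dom :=
  h.2.2.1

/-- The velocity of a visible incomplete null ray is null. [folklore] -/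
lemma isNull_velocity (h : g.IsVisibleIncompleteNullRay τ ι N γ dom) {t : ℝ} (ht : t ∈ dom) :
    g.IsNull (velocity I γ t) :=
  (h.2.2.2.1 t ht).1

/-- The velocity of a visible incomplete null ray is future-directed. [folklore] -/
lemma isFutureDirected_velocity (h : g.IsVisibleIncompleteNullRay τ ι N γ dom) {t : ℝ}
    (ht : t ∈ dom) : τ.IsFutureDirected (velocity I γ t) :=
  (h.2.2.2.1 t ht).2

/-- Every event of nonnegative parameter on a visible incomplete null ray is visible from
infinity. Hawking–Ellis 1973, §9.2, p. 311. [cite: HawkingEllis1973CUP, §9.2, p. 311] -/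
lemma isVisibleEvent (h : g.IsVisibleIncompleteNullRay τ ι N γ dom) {t : ℝ} (ht : t ∈ dom)
    (h0 : 0 ≤ t) : g.IsVisibleEvent τ ι N (γ t) :=
  h.2.2.2.2 t ht h0

/-- The starting event `γ 0` of a visible incomplete null ray is visible from infinity.
[folklore] -/
lemma isVisibleEvent_zero (h : g.IsVisibleIncompleteNullRay τ ι N γ dom) :
    g.IsVisibleEvent τ ι N (γ 0) :=
  h.isVisibleEvent h.zero_mem le_rfl

/-- The nonnegative-parameter half of a visible incomplete null ray lies in the visible region.
Hawking–Ellis 1973, §9.2, p. 311. [cite: HawkingEllis1973CUP, §9.2, p. 311] -/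
lemma image_subset_visibleRegion (h : g.IsVisibleIncompleteNullRay τ ι N γ dom) :
    γ '' (dom ∩ Ici 0) ⊆ g.visibleRegion τ ι N := by
  rintro _ ⟨t, ⟨ht, h0⟩, rfl⟩
  exact h.isVisibleEvent ht h0

/-- **A spacetime with a visible incomplete null ray is future null geodesically incomplete**
(`IsFutureNullGeodesicallyIncomplete`: a maximal geodesic with nonempty affine domain bounded
above and null future-directed velocities). Hawking–Ellis 1973, §8.1, pp. 257–258.
[cite: HawkingEllis1973CUP, §8.1, pp. 257–258] -/
theorem isFutureNullGeodesicallyIncomplete (h : g.IsVisibleIncompleteNullRay τ ι N γ dom) :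
    IsFutureNullGeodesicallyIncomplete τ :=
  ⟨γ, dom, h.isMaximalGeodesicOn, h.nonempty, h.bddAbove, h.2.2.2.1⟩

/-- **A spacetime with a visible incomplete null ray is not null geodesically complete** (it is
singular in the sense of Hawking–Ellis, §8.1): on a Hausdorff manifold without boundary whose
Levi-Civita connection is `C¹`, the null vector `γ' 0` is not the initial velocity of a geodesic
defined on all of `ℝ`, by uniqueness of geodesics
(`not_isNullGeodesicallyComplete_of_isFutureNullGeodesicallyIncomplete_holds`). Hawking–Ellis
1973, §8.1, pp. 257–258. [cite: HawkingEllis1973CUP, §8.1, pp. 257–258] -/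
theorem not_isNullGeodesicallyComplete [T2Space M] [BoundarylessManifold I M]
    [CovariantDerivative.ContMDiffCovariantDerivative g.leviCivita 1]
    (h : g.IsVisibleIncompleteNullRay τ ι N γ dom) : ¬ g.IsNullGeodesicallyComplete :=
  not_isNullGeodesicallyComplete_of_isFutureNullGeodesicallyIncomplete_holds τ
    h.isFutureNullGeodesicallyIncomplete

end IsVisibleIncompleteNullRay

end LorentzianMetric

/-! ### Data embeddings and Cauchy developments -/

namespace DataEmbedding

universe u

variable {n : ℕ} {X : Type u} [TopologicalSpace X] [ChartedSpace (EuclideanSpace ℝ (Fin n)) X]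
  [IsManifold (𝓡 n) ∞ X] [ConnectedSpace X] {D : InitialDataSet (𝓡 n) X}

/-- The event `q` of the data embedding / Cauchy development `𝒟 = (M, g, τ, ι, ν)` of the initial
data set `D` **is visible from infinity**: `LorentzianMetric.IsVisibleEvent` for the metric, time
orientation, embedding `ι = 𝒟.embed` and future unit normal `ν = 𝒟.normal` of `𝒟` — `q` lies in
the chronological past `I⁻(δ(s ∩ [0, ∞)))` of a future-complete normalised null ray `δ` from the
data hypersurface (the intrinsic `q ∈ J⁻(𝓘⁺)`, `q ∉ B = M ∖ J⁻(𝓘⁺)`: Hawking–Ellis 1973, §9.2,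
p. 312; Wald 1984, §12.1, p. 300; Dafermos–Rodnianski, arXiv:0811.0354, §2.5.4). The standing
Levi-Civita hypothesis `[𝒟.metric.HasLeviCivita]` is taken from the context, as the route
statements bind it. For `𝒟 : CauchyDevelopment D` or `VacuumCauchyDevelopment D` write
`𝒟.IsVisibleEvent q` (dot notation through `toDataEmbedding`). [cite: HawkingEllis1973CUP, §9.2, p. 312] -/
def IsVisibleEvent (𝒟 : DataEmbedding D) [𝒟.metric.HasLeviCivita] (q : 𝒟.carrier) : Prop :=
  𝒟.metric.IsVisibleEvent 𝒟.timeOrientation 𝒟.embed 𝒟.normal q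

/-- The **visible region** `I⁻(𝓘⁺) ∩ M` (intrinsic form) of the data embedding / Cauchy
development `𝒟`: its events visible from infinity (`LorentzianMetric.visibleRegion` for the fields
of `𝒟`), the complement of the intrinsic black-hole region. Wald 1984, §12.1, p. 300;
Hawking–Ellis 1973, §9.2, p. 312. [cite: Wald1984GR, §12.1, p. 300] -/
def visibleRegion (𝒟 : DataEmbedding D) [𝒟.metric.HasLeviCivita] : Set 𝒟.carrier :=
  𝒟.metric.visibleRegion 𝒟.timeOrientation 𝒟.embed 𝒟.normal

/-- `γ` with affine domain `dom` is a **visible future-incomplete null ray of the data embedding /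
Cauchy development `𝒟 = (M, g, τ, ι, ν)`**: `LorentzianMetric.IsVisibleIncompleteNullRay` for
the fields of `𝒟` — a maximal null geodesic on the open interval `dom ∋ 0`, bounded above
(future incomplete), with future-directed null velocity, every event `γ t`, `t ≥ 0`, of which lies
in the chronological past of the nonnegative half of a future-complete normalised null ray from
`ι(X)`. Verbatim the predicate inlined in route `FinalStateConjecture/CurvatureOrSymmetry`
(`DataEmbedding.isVisibleIncompleteNullRay_iff`); for `𝒟 : VacuumCauchyDevelopment D` write
`𝒟.IsVisibleIncompleteNullRay γ dom`. Hawking–Ellis 1973, §8.1, pp. 257–258 (incomplete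
geodesics), §9.2, p. 311 ("naked, i.e. visible from `𝓘⁺`"). [cite: HawkingEllis1973CUP, §9.2, p. 311, and §8.1, pp. 257–258] -/
def IsVisibleIncompleteNullRay (𝒟 : DataEmbedding D) [𝒟.metric.HasLeviCivita]
    (γ : ℝ → 𝒟.carrier) (dom : Set ℝ) : Prop :=
  𝒟.metric.IsVisibleIncompleteNullRay 𝒟.timeOrientation 𝒟.embed 𝒟.normal γ dom

variable (𝒟 : DataEmbedding D) [𝒟.metric.HasLeviCivita]

/-- Unfolding lemma: `𝒟.IsVisibleEvent q` is, verbatim, the visibility clause inlined in the routes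
`CurvatureOrSymmetry` and `BondiDrainDispersal`. [folklore] -/
lemma isVisibleEvent_iff {q : 𝒟.carrier} :
    𝒟.IsVisibleEvent q ↔
      ∃ (p : X) (δ : ℝ → 𝒟.carrier) (s : Set ℝ),
        𝒟.metric.IsNormalisedNullRayFrom 𝒟.timeOrientation 𝒟.embed 𝒟.normal p δ s ∧
          ¬ BddAbove s ∧ q ∈ 𝒟.metric.chronologicalPast 𝒟.timeOrientation (δ '' (s ∩ Set.Ici 0)) :=
  Iff.rfl

/-- Membership in the visible region of `𝒟`. [folklore] -/
@[simp]
lemma mem_visibleRegion_iff {q : 𝒟.carrier} : q ∈ 𝒟.visibleRegion ↔ 𝒟.IsVisibleEvent q :=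
  Iff.rfl

/-- **The horizon idiom of route `BondiDrainDispersal`** for `𝒟`: an event is invisible from
infinity iff it lies outside `I⁻(γ(dom ∩ [0, ∞)))` for every future-complete normalised null ray
`γ` from the data hypersurface (verbatim the inlined predicate; "`𝒟` has an event horizon" there
reads `∃ q, ¬ 𝒟.IsVisibleEvent q`). Wald 1984, §12.1, p. 300. [cite: Wald1984GR, §12.1, p. 300] -/
lemma not_isVisibleEvent_iff {q : 𝒟.carrier} :
    ¬ 𝒟.IsVisibleEvent q ↔
      ∀ (p : X) (γ : ℝ → 𝒟.carrier) (dom : Set ℝ),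
        𝒟.metric.IsNormalisedNullRayFrom 𝒟.timeOrientation 𝒟.embed 𝒟.normal p γ dom →
          ¬ BddAbove dom →
            q ∉ 𝒟.metric.chronologicalPast 𝒟.timeOrientation (γ '' (dom ∩ Set.Ici 0)) :=
  LorentzianMetric.not_isVisibleEvent_iff

/-- Unfolding lemma: `𝒟.IsVisibleIncompleteNullRay γ dom` is, verbatim, the predicate on
`(γ, dom)` inlined in the items `NoFourthExit`, `NoVacuumFountains`, `CurvatureModeExit`,
`VisibleIncompleteRay` of route `FinalStateConjecture/CurvatureOrSymmetry`. [folklore] -/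
lemma isVisibleIncompleteNullRay_iff {γ : ℝ → 𝒟.carrier} {dom : Set ℝ} :
    𝒟.IsVisibleIncompleteNullRay γ dom ↔
      IsMaximalGeodesicOn 𝒟.metric.leviCivita γ dom ∧ (0 : ℝ) ∈ dom ∧ BddAbove dom ∧
        (∀ t ∈ dom, 𝒟.metric.IsNull (velocity (𝓡 (n + 1)) γ t) ∧
          𝒟.timeOrientation.IsFutureDirected (velocity (𝓡 (n + 1)) γ t)) ∧
        ∀ t ∈ dom, 0 ≤ t → ∃ (p : X) (δ : ℝ → 𝒟.carrier) (s : Set ℝ),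
          𝒟.metric.IsNormalisedNullRayFrom 𝒟.timeOrientation 𝒟.embed 𝒟.normal p δ s ∧
            ¬ BddAbove s ∧
              γ t ∈ 𝒟.metric.chronologicalPast 𝒟.timeOrientation (δ '' (s ∩ Set.Ici 0)) :=
  Iff.rfl

/-- The visibility clause of a visible incomplete null ray of `𝒟`, in terms of
`𝒟.IsVisibleEvent`. [folklore] -/
lemma IsVisibleIncompleteNullRay.isVisibleEvent {γ : ℝ → 𝒟.carrier} {dom : Set ℝ}
    (h : 𝒟.IsVisibleIncompleteNullRay γ dom) {t : ℝ} (ht : t ∈ dom) (h0 : 0 ≤ t) :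
    𝒟.IsVisibleEvent (γ t) :=
  LorentzianMetric.IsVisibleIncompleteNullRay.isVisibleEvent h ht h0

/-- **The visible region of a data embedding / Cauchy development is a past set**
(`LorentzianMetric.isPastSet_visibleRegion`). Hawking–Ellis 1973, §6.8, p. 217; §9.2, p. 312.
[cite: HawkingEllis1973CUP, §6.8, p. 217] -/
theorem isPastSet_visibleRegion : 𝒟.metric.IsPastSet 𝒟.timeOrientation 𝒟.visibleRegion :=
  LorentzianMetric.isPastSet_visibleRegion _ _ _ _

/-- **The visible region of a data embedding / Cauchy development is open** (its carrier is a
manifold without boundary, modelled on `ℝⁿ⁺¹`). O'Neill 1983, Ch. 14, Lemma 14.3;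
Hawking–Ellis 1973, §9.2, p. 312. [cite: HawkingEllis1973CUP, §9.2, p. 312] -/
theorem isOpen_visibleRegion : IsOpen 𝒟.visibleRegion :=
  LorentzianMetric.isOpen_visibleRegion _ _ _ _

/-- A data embedding / Cauchy development with a visible incomplete null ray is future null
geodesically incomplete and, its carrier being Hausdorff without boundary, not null geodesically
complete as soon as its Levi-Civita connection is `C¹`. Hawking–Ellis 1973, §8.1, pp. 257–258.
[cite: HawkingEllis1973CUP, §8.1, pp. 257–258] -/
theorem IsVisibleIncompleteNullRay.not_isNullGeodesicallyComplete
    [CovariantDerivative.ContMDiffCovariantDerivative 𝒟.metric.leviCivita 1]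
    {γ : ℝ → 𝒟.carrier} {dom : Set ℝ} (h : 𝒟.IsVisibleIncompleteNullRay γ dom) :
    ¬ 𝒟.metric.IsNullGeodesicallyComplete :=
  LorentzianMetric.IsVisibleIncompleteNullRay.not_isNullGeodesicallyComplete h

end DataEmbedding

end Literature.Geometry.Lorentzian

end
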